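import Literature.Analysis.FluidPDE.TypeIAncientMild
import Literature.Analysis.FluidPDE.TsaiLocalEnergyScaling

/-!
# Crux `FiniteDissipationLiouville` (stmt-NavierStokesRegularity-22144), negative side:
# Leray's quarter-rate dissipation law and apex-singularity are exactly scale invariant

Negative-side (cdisprove) support for the crux `FiniteDissipationLiouville` of route
`LerayQuarterDissipation`. Its two crux-specific clauses — the dissipation law
`∫ ‖Dū(s)‖ₑ² ≤ K/√(−s)` (`s < 0`) and "singular at the apex" (unbounded in every backward cylinder
`(−r², 0) × B_r`) — are invariant under the Navier–Stokes scaling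
`ū ↦ ū_c`, `ū_c(t,x) = c ū(c²t, cx)` (`Literature.Analysis.FluidPDE.nsRescale`, `0 < c`) WITH THE
SAME CONSTANT `K`:

* `dissLaw_nsRescale` — `∫ ‖D(ū_c)(s)‖ₑ² = c ∫ ‖Dū(c²s)‖ₑ² ≤ c K/√(−c²s) = K/√(−s)` (chain rule
  `D(ū_c)(s) = c² Dū(c²s)(c·)`, tree `fderiv_smul_comp_smul`, and the dilation of Lebesgue measure
  on `ℝ³`, tree `lintegral_comp_smul_fin3`); the law is CRITICAL: `K` is dimensionless;
* `singularAtApex_nsRescale` — zooms of an apex-singular field are apex-singular;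
  `singularAtApex_nsRescale_iff` — and conversely.

Consequence for the line (no smallness by zooming): together with the scale invariance of the
Type-I constant `C`, neither `K` nor `C` of a putative counterexample can be normalised small
along its scaling orbit, so the small-dissipation leaf (`K ≤ K₀`, CKN) and the small-constant gap
(`C ≤ ε₀`) do not bootstrap to the crux; a blow-up/blow-down limit inherits the same `K`
(lower semicontinuity), which is what makes the class of the recurrent reduction compact AND
non-trivial at the same time.

No definitions, no route import (clauses inlined verbatim); standard axioms.
-/

noncomputable section

open Set Function Filter MeasureTheory
open scoped Topology ENNReal

namespace Summit.NavierStokesRegularity.NavierStokesRegularity.Theorems.FiniteDissipationLiouville.Negative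

open Literature.Analysis.FluidPDE

/-- **Leray's quarter-rate dissipation law is scale invariant with the same constant.** -/
theorem dissLaw_nsRescale {K c : ℝ} (hc : 0 < c)
    {u : ℝ → EuclideanSpace ℝ (Fin 3) → EuclideanSpace ℝ (Fin 3)}
    (hD : ∀ s : ℝ, s < 0 → ∫⁻ x, ‖fderiv ℝ (u s) x‖ₑ ^ 2 ≤ ENNReal.ofReal (K / Real.sqrt (-s))) :
    ∀ s : ℝ, s < 0 →
      ∫⁻ x, ‖fderiv ℝ (nsRescale c u s) x‖ₑ ^ 2 ≤ ENNReal.ofReal (K / Real.sqrt (-s)) := by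
  intro s hs
  have hc2 : 0 < c ^ 2 := by positivity
  have hcs : c ^ 2 * s < 0 := mul_neg_of_pos_of_neg hc2 hs
  have hpt : ∀ x, ‖fderiv ℝ (nsRescale c u s) x‖ₑ ^ 2 =
      ENNReal.ofReal ((c ^ 2) ^ 2) * ‖fderiv ℝ (u (c ^ 2 * s)) (c • x)‖ₑ ^ 2 := by
    intro x
    rw [show nsRescale c u s = fun y => c • u (c ^ 2 * s) (c • y) from rfl,
      fderiv_smul_comp_smul (u (c ^ 2 * s)) c x, ← ofReal_norm, ← ofReal_norm, norm_smul,
      Real.norm_eq_abs, abs_of_pos hc2, ENNReal.ofReal_mul hc2.le, mul_pow,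
      ← ENNReal.ofReal_pow hc2.le]
  have hsq : 0 < Real.sqrt (-s) := Real.sqrt_pos.2 (by linarith)
  calc ∫⁻ x, ‖fderiv ℝ (nsRescale c u s) x‖ₑ ^ 2
      = ENNReal.ofReal ((c ^ 2) ^ 2) * ∫⁻ x, ‖fderiv ℝ (u (c ^ 2 * s)) (c • x)‖ₑ ^ 2 := by
        simp_rw [hpt]
        exact lintegral_const_mul' _ _ ENNReal.ofReal_ne_top
    _ = ENNReal.ofReal ((c ^ 2) ^ 2) * (ENNReal.ofReal ((c ^ 3)⁻¹) *
          ∫⁻ y, ‖fderiv ℝ (u (c ^ 2 * s)) y‖ₑ ^ 2) := by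
        rw [lintegral_comp_smul_fin3 (fun y => ‖fderiv ℝ (u (c ^ 2 * s)) y‖ₑ ^ 2) hc]
    _ ≤ ENNReal.ofReal ((c ^ 2) ^ 2) * (ENNReal.ofReal ((c ^ 3)⁻¹) *
          ENNReal.ofReal (K / Real.sqrt (-(c ^ 2 * s)))) := by
        gcongr
        exact hD _ hcs
    _ = ENNReal.ofReal (K / Real.sqrt (-s)) := by
        rw [← ENNReal.ofReal_mul (by positivity), ← ENNReal.ofReal_mul (by positivity)]
        congr 1
        rw [neg_mul_eq_mul_neg, Real.sqrt_mul hc2.le, Real.sqrt_sq hc.le]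
        field_simp

/-- **Zooms of an apex-singular field are apex-singular** (`0 < c`): if `u` is unbounded in
every backward cylinder `(−r², 0) × B_r`, so is `u_c = c u(c²·, c·)` — the witnesses at radius
`c r` and level `M/c` pull back to radius `r` and level `M`. -/
theorem singularAtApex_nsRescale {c : ℝ} (hc : 0 < c)
    {u : ℝ → EuclideanSpace ℝ (Fin 3) → EuclideanSpace ℝ (Fin 3)}
    (hu : ∀ r > 0, ∀ M : ℝ, ∃ t ∈ Set.Ioo (-(r ^ 2)) (0 : ℝ),
      ∃ x ∈ Metric.ball (0 : EuclideanSpace ℝ (Fin 3)) r, M < ‖u t x‖) :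
    ∀ r > 0, ∀ M : ℝ, ∃ t ∈ Set.Ioo (-(r ^ 2)) (0 : ℝ),
      ∃ x ∈ Metric.ball (0 : EuclideanSpace ℝ (Fin 3)) r, M < ‖nsRescale c u t x‖ := by
  intro r hr M
  obtain ⟨t, ht, x, hx, hM⟩ := hu (c * r) (by positivity) (M / c)
  refine ⟨t / c ^ 2, ⟨?_, div_neg_of_neg_of_pos ht.2 (by positivity)⟩, c⁻¹ • x, ?_, ?_⟩
  · rw [lt_div_iff₀ (by positivity)]
    have := ht.1
    nlinarith
  · rw [Metric.mem_ball, dist_zero_right, norm_smul, norm_inv, Real.norm_eq_abs, abs_of_pos hc,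
      inv_mul_lt_iff₀ hc]
    rwa [Metric.mem_ball, dist_zero_right] at hx
  · rw [nsRescale_apply, mul_div_cancel₀ _ (pow_ne_zero 2 hc.ne'), smul_inv_smul₀ hc.ne',
      norm_smul, Real.norm_eq_abs, abs_of_pos hc]
    rwa [div_lt_iff₀' hc] at hM

/-- Apex-singularity is scale invariant (`0 < c`). -/
theorem singularAtApex_nsRescale_iff {c : ℝ} (hc : 0 < c)
    {u : ℝ → EuclideanSpace ℝ (Fin 3) → EuclideanSpace ℝ (Fin 3)} :
    (∀ r > 0, ∀ M : ℝ, ∃ t ∈ Set.Ioo (-(r ^ 2)) (0 : ℝ),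
        ∃ x ∈ Metric.ball (0 : EuclideanSpace ℝ (Fin 3)) r, M < ‖nsRescale c u t x‖) ↔
      ∀ r > 0, ∀ M : ℝ, ∃ t ∈ Set.Ioo (-(r ^ 2)) (0 : ℝ),
        ∃ x ∈ Metric.ball (0 : EuclideanSpace ℝ (Fin 3)) r, M < ‖u t x‖ := by
  refine ⟨fun h => ?_, singularAtApex_nsRescale hc⟩
  have h' := singularAtApex_nsRescale (inv_pos.2 hc) h
  rwa [nsRescale_inv_nsRescale hc.ne'] at h'

end Summit.NavierStokesRegularity.NavierStokesRegularity.Theorems.FiniteDissipationLiouville.Negative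

end
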